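import Summits.SmoothPoincare4.SmoothPoincare4.Theses.PIC
import Summits.SmoothPoincare4.SmoothPoincare4.Theses.PscCorkFillIn
import Literature.Topology.FourManifolds.CorkDecompositionInvolutiveProofs
import Literature.Topology.FourManifolds.ThetaFourKervaireMilnorFrontier
import Literature.Geometry.Riemannian.BaerHankeGluing
import HarnessLib

/-!
# Line `swap-sum` of crux `CorkRegluablePsc` (stmt-SmoothPoincare4-3206): its bet `stub_crossFilling` already yields PSC on every homotopy 4-sphere

Lead c3 certificate (helper, `--supports stmt-SmoothPoincare4-3206`).  The registered load-bearing
stub `stub_crossFilling` of the skeleton `Cruxes/CorkRegluablePsc/Lines/swap_sum.lean` asks, for every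
Matveyev triple `(W₁, W₂, M; φ₁, φ₂)` of the standard sphere, for Riemannian PSC metrics `g₁, g₂, g_M`
on the three pieces inducing ONE boundary metric and satisfying the four one-sided conditions
(i) `H₁ + H_M∘φ₁ ≥ 0`, (ii) `H₂ + H_M∘φ₂ ≥ 0`, (iii) `H₁ + H₂∘φ₂⁻¹φ₁ ≥ 0`, (iv) `H₁ ≥ 0`.  The line
card advertises that "no statement about `Σ` is presupposed" (the hypotheses name only `S⁴`).  This
file records, kernel-checked, that the CONCLUSION does: the pair `(g₂, g_M)` with the common boundary
form and condition (ii) alone is verbatim the hypothesis of Bär–Hanke's gluing theorem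
(`Literature.Geometry.Riemannian.BaerHankePscGluing`, §4.4 Thm. 42) for the gluing
`Σ = W₂ ∪_{φ₂} M`, so

* `psc_of_crossFillingPair` — for ANY boundaryless smooth 4-manifold `X` glued from `W₂` and `M`
  along `φ₂`, metrics `g₂, g_M` as in the stub's conclusion (only (ii) and the `W₂`/`M` boundary-form
  identity are used) give a Riemannian PSC metric on `X` (one application of the gluing fact);
* `picPscV2_of_crossFilling` — modulo the same three literature leaves the line already carries
  (Kervaire–Milnor Thm. 3.1 at `n = 4`, `Π₄ = 0`, Matveyev (H4)) and the Bär–Hanke gluing fact, the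
  statement of `stub_crossFilling` implies route PIC's wall
  `Summit.SmoothPoincare4.SmoothPoincare4.Theses.PIC.PicPscV2` ("every homotopy 4-sphere carries a PSC
  metric", open in print) BY NAME — without the swap, the connected sums or any symmetry;
* `pscAllHomotopySpheres_of_crossFilling` — the same conclusion under its other name
  `…Theses.PscCorkFillIn.PscAllHomotopySpheres` (retired route PscCorkFillIn).

Consequence for the line's grading: `stub_crossFilling` is at least as strong as PSC on every homotopy
4-sphere, exactly like line `birth`'s promoted stub 2A; the swap machinery (`stub_swapSum`) is needed
only to upgrade PSC-on-`Σ` to the ISOMETRIC regluing the crux asks for.  (The stub is moreover a `∀`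
over all abstract Matveyev triples, which — unlike the crux — is not visibly implied by SPC4; see the
lead report `Cruxes/CorkRegluablePsc/LeadC3-Report.md`.)

References: [BarHanke2023] §4.4 Thm. 42 (arXiv:2012.09127) and the sentence following it;
[Matveyev1996] Thm. 1 and Fact 1; [KervaireMilnorAnnals1963] Thm. 3.1, §4.
-/

set_option linter.dupNamespace false

noncomputable section

open scoped Manifold ContDiff Topology

namespace Summit.SmoothPoincare4.SmoothPoincare4.Theorems

/-- **One Bär–Hanke gluing**: for a boundary gluing `X = W₂ ∪_{φ₂} M` of compact smooth 4-manifolds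
with boundary (any boundaryless carrier `X`), Riemannian PSC metrics `g₂` on `W₂` and `g_M` on `M` with
smooth outward unit normals, equal induced boundary forms under `φ₂` and `H₂(w) + H_M(φ₂ w) ≥ 0` give a
Riemannian PSC metric on `X`.  This is `BaerHankePscGluing.dim_four` with the existential hypothesis
assembled from separate data — the shape in which `stub_crossFilling` delivers `(g₂, g_M)` and (ii).
[cite: BarHanke2023, §4.4 Thm. 42 (arXiv:2012.09127) and the sentence following it] -/
theorem psc_of_crossFillingPair (hBH : Literature.Geometry.Riemannian.BaerHankePscGluing)
    {W₂ : Type} [TopologicalSpace W₂] [T2Space W₂] [SecondCountableTopology W₂]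
    [ChartedSpace (EuclideanHalfSpace 4) W₂] [IsManifold (𝓡∂ 4) ∞ W₂] [CompactSpace W₂]
    (b₂ : Literature.Topology.FourManifolds.BoundaryData (𝓡∂ 4) W₂ (𝓡 3))
    {M : Type} [TopologicalSpace M] [T2Space M] [SecondCountableTopology M]
    [ChartedSpace (EuclideanHalfSpace 4) M] [IsManifold (𝓡∂ 4) ∞ M] [CompactSpace M]
    (bM : Literature.Topology.FourManifolds.BoundaryData (𝓡∂ 4) M (𝓡 3))
    (φ₂ : b₂.carrier ≃ₘ⟮𝓡 3, 𝓡 3⟯ bM.carrier)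
    {X : Type} [TopologicalSpace X] [T2Space X] [SecondCountableTopology X]
    [ChartedSpace (EuclideanSpace ℝ (Fin 4)) X] [IsManifold (𝓡 4) ∞ X]
    (hX : Literature.Topology.FourManifolds.IsBoundaryGluing b₂ bM φ₂ (𝓡 4) X)
    (g₂ : Literature.Geometry.Lorentzian.PseudoRiemannianMetric (𝓡∂ 4) ∞ (EuclideanSpace ℝ (Fin 4)) (TangentSpace (𝓡∂ 4) : W₂ → Type _))
    (hL₂ : g₂.HasLeviCivita) (hf₂ : g₂.IsSpacelikeImmersion (𝓡 3) b₂.incl)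
    (ν₂ : Literature.Geometry.Lorentzian.NormalField (𝓡∂ 4) b₂.incl)
    (gM : Literature.Geometry.Lorentzian.PseudoRiemannianMetric (𝓡∂ 4) ∞ (EuclideanSpace ℝ (Fin 4)) (TangentSpace (𝓡∂ 4) : M → Type _))
    (hLM : gM.HasLeviCivita) (hfM : gM.IsSpacelikeImmersion (𝓡 3) bM.incl)
    (νM : Literature.Geometry.Lorentzian.NormalField (𝓡∂ 4) bM.incl)
    (hg₂ : g₂.IsRiemannian ∧ (∀ x, 0 < g₂.scalarCurvature x) ∧ g₂.IsUnitNormal (𝓡 3) b₂.incl ν₂ 1 ∧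
      ContMDiff (𝓡 3) (𝓡∂ 4).tangent ∞ (fun w ↦ (Bundle.TotalSpace.mk' (EuclideanSpace ℝ (Fin 4)) (b₂.incl w) (ν₂ w) : TangentBundle (𝓡∂ 4) W₂)) ∧
      (∀ w, (show EuclideanSpace ℝ (Fin 4) from ν₂ w) 0 < 0))
    (hgM : gM.IsRiemannian ∧ (∀ x, 0 < gM.scalarCurvature x) ∧ gM.IsUnitNormal (𝓡 3) bM.incl νM 1 ∧
      ContMDiff (𝓡 3) (𝓡∂ 4).tangent ∞ (fun m ↦ (Bundle.TotalSpace.mk' (EuclideanSpace ℝ (Fin 4)) (bM.incl m) (νM m) : TangentBundle (𝓡∂ 4) M)) ∧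
      (∀ m, (show EuclideanSpace ℝ (Fin 4) from νM m) 0 < 0))
    (hb₂ : ∀ w, Literature.Geometry.Lorentzian.pullbackBilin (I := 𝓡∂ 4) (I' := 𝓡 3) b₂.incl g₂.val w =
      Literature.Geometry.Lorentzian.pullbackBilin (I := 𝓡∂ 4) (I' := 𝓡 3) (bM.incl ∘ φ₂) gM.val w)
    (hii : ∀ w, 0 ≤ g₂.meanCurvature b₂.incl Literature.Geometry.Lorentzian.PseudoRiemannianMetric.contMDiff_pullbackBilin_holds hf₂ ν₂ w +
      gM.meanCurvature bM.incl Literature.Geometry.Lorentzian.PseudoRiemannianMetric.contMDiff_pullbackBilin_holds hfM νM (φ₂ w)) :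
    ∃ g : Literature.Geometry.Lorentzian.PseudoRiemannianMetric (𝓡 4) ∞ (EuclideanSpace ℝ (Fin 4)) (TangentSpace (𝓡 4) : X → Type _),
      ∃ _ : g.HasLeviCivita, g.IsRiemannian ∧ ∀ x, 0 < g.scalarCurvature x :=
  hBH.dim_four W₂ b₂ M bM φ₂ X hX ⟨g₂, hL₂, hf₂, ν₂, gM, hLM, hfM, νM, hg₂, hgM, hb₂, hii⟩

/-- **The bet of line `swap-sum` implies route PIC's wall `PicPscV2`** (PSC on every homotopy 4-sphere),
modulo the line's own literature leaves — Kervaire–Milnor Thm. 3.1 at `n = 4` (`h31`), `Π₄ = 0`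
(`hPi`), Matveyev (H4) (`h4`) — and the Bär–Hanke gluing fact (`hBH`).  Proof: `Θ₄ = 0` (the tree's
Kervaire–Milnor chain) makes `Σ` h-cobordant to `S⁴`; Matveyev's Thm. 1 part 1 with Fact 1 presents
`Σ = W₂ ∪_{φ₂} M` inside a Matveyev triple of `S⁴`; the hypothesis `hA` (= the statement of
`stub_crossFilling`, verbatim) supplies `g₂, g_M` with one boundary form and (ii); one Bär–Hanke gluing
(`psc_of_crossFillingPair`) gives the PSC metric on `Σ`.  Conditions (i), (iii), (iv), the metric `g₁`
and the double `D(W₁) = S⁴` are not used. [folklore] -/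
theorem picPscV2_of_crossFilling (hBH : Literature.Geometry.Riemannian.BaerHankePscGluing)
    (h31 : ∀ S : Literature.Topology.FourManifolds.HomotopySphere 4,
      Literature.Topology.FourManifolds.IsStablyParallelizable (𝓡 4) S.carrier)
    (hPi : Literature.Topology.FourManifolds.piStable_four_trivial)
    (h4 : Literature.Topology.FourManifolds.Matveyev1996_partOne_and_fact_of_dualSpheres.{0})
    (hA :

      ∀ (W₁ : Type) [TopologicalSpace W₁] [T2Space W₁] [SecondCountableTopology W₁]
      [ChartedSpace (EuclideanHalfSpace 4) W₁] [IsManifold (𝓡∂ 4) ∞ W₁] [CompactSpace W₁] [ContractibleSpace W₁]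
      (b₁ : Literature.Topology.FourManifolds.BoundaryData (𝓡∂ 4) W₁ (𝓡 3))
      (W₂ : Type) [TopologicalSpace W₂] [T2Space W₂] [SecondCountableTopology W₂]
      [ChartedSpace (EuclideanHalfSpace 4) W₂] [IsManifold (𝓡∂ 4) ∞ W₂] [CompactSpace W₂] [ContractibleSpace W₂]
      (b₂ : Literature.Topology.FourManifolds.BoundaryData (𝓡∂ 4) W₂ (𝓡 3))
      (M : Type) [TopologicalSpace M] [T2Space M] [SecondCountableTopology M]
      [ChartedSpace (EuclideanHalfSpace 4) M] [IsManifold (𝓡∂ 4) ∞ M] [CompactSpace M]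
      (bM : Literature.Topology.FourManifolds.BoundaryData (𝓡∂ 4) M (𝓡 3))
      (φ₁ : b₁.carrier ≃ₘ⟮𝓡 3, 𝓡 3⟯ bM.carrier) (φ₂ : b₂.carrier ≃ₘ⟮𝓡 3, 𝓡 3⟯ bM.carrier),
      Literature.Topology.FourManifolds.IsBoundaryGluing b₁ bM φ₁ (𝓡 4) (Metric.sphere (0 : EuclideanSpace ℝ (Fin 5)) 1) →
      Literature.Topology.FourManifolds.IsDouble b₁ (𝓡 4) (Metric.sphere (0 : EuclideanSpace ℝ (Fin 5)) 1) →
      Literature.Topology.FourManifolds.IsBoundaryGluing b₁ b₂ (φ₁.trans φ₂.symm) (𝓡 4) (Metric.sphere (0 : EuclideanSpace ℝ (Fin 5)) 1) →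
      ∃ (g₁ : Literature.Geometry.Lorentzian.PseudoRiemannianMetric (𝓡∂ 4) ∞ (EuclideanSpace ℝ (Fin 4)) (TangentSpace (𝓡∂ 4) : W₁ → Type _))
      (_ : g₁.HasLeviCivita) (hf₁ : g₁.IsSpacelikeImmersion (𝓡 3) b₁.incl)
      (ν₁ : Literature.Geometry.Lorentzian.NormalField (𝓡∂ 4) b₁.incl)
      (g₂ : Literature.Geometry.Lorentzian.PseudoRiemannianMetric (𝓡∂ 4) ∞ (EuclideanSpace ℝ (Fin 4)) (TangentSpace (𝓡∂ 4) : W₂ → Type _))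
      (_ : g₂.HasLeviCivita) (hf₂ : g₂.IsSpacelikeImmersion (𝓡 3) b₂.incl)
      (ν₂ : Literature.Geometry.Lorentzian.NormalField (𝓡∂ 4) b₂.incl)
      (gM : Literature.Geometry.Lorentzian.PseudoRiemannianMetric (𝓡∂ 4) ∞ (EuclideanSpace ℝ (Fin 4)) (TangentSpace (𝓡∂ 4) : M → Type _))
      (_ : gM.HasLeviCivita) (hfM : gM.IsSpacelikeImmersion (𝓡 3) bM.incl)
      (νM : Literature.Geometry.Lorentzian.NormalField (𝓡∂ 4) bM.incl),
      (g₁.IsRiemannian ∧ (∀ x, 0 < g₁.scalarCurvature x) ∧ g₁.IsUnitNormal (𝓡 3) b₁.incl ν₁ 1 ∧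
        ContMDiff (𝓡 3) (𝓡∂ 4).tangent ∞ (fun z ↦ (Bundle.TotalSpace.mk' (EuclideanSpace ℝ (Fin 4)) (b₁.incl z) (ν₁ z) : TangentBundle (𝓡∂ 4) W₁)) ∧
        (∀ z, (show EuclideanSpace ℝ (Fin 4) from ν₁ z) 0 < 0)) ∧
      (g₂.IsRiemannian ∧ (∀ x, 0 < g₂.scalarCurvature x) ∧ g₂.IsUnitNormal (𝓡 3) b₂.incl ν₂ 1 ∧
        ContMDiff (𝓡 3) (𝓡∂ 4).tangent ∞ (fun w ↦ (Bundle.TotalSpace.mk' (EuclideanSpace ℝ (Fin 4)) (b₂.incl w) (ν₂ w) : TangentBundle (𝓡∂ 4) W₂)) ∧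
        (∀ w, (show EuclideanSpace ℝ (Fin 4) from ν₂ w) 0 < 0)) ∧
      (gM.IsRiemannian ∧ (∀ x, 0 < gM.scalarCurvature x) ∧ gM.IsUnitNormal (𝓡 3) bM.incl νM 1 ∧
        ContMDiff (𝓡 3) (𝓡∂ 4).tangent ∞ (fun m ↦ (Bundle.TotalSpace.mk' (EuclideanSpace ℝ (Fin 4)) (bM.incl m) (νM m) : TangentBundle (𝓡∂ 4) M)) ∧
        (∀ m, (show EuclideanSpace ℝ (Fin 4) from νM m) 0 < 0)) ∧
      (∀ z, Literature.Geometry.Lorentzian.pullbackBilin (I := 𝓡∂ 4) (I' := 𝓡 3) b₁.incl g₁.val z =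
        Literature.Geometry.Lorentzian.pullbackBilin (I := 𝓡∂ 4) (I' := 𝓡 3) (bM.incl ∘ φ₁) gM.val z) ∧
      (∀ w, Literature.Geometry.Lorentzian.pullbackBilin (I := 𝓡∂ 4) (I' := 𝓡 3) b₂.incl g₂.val w =
        Literature.Geometry.Lorentzian.pullbackBilin (I := 𝓡∂ 4) (I' := 𝓡 3) (bM.incl ∘ φ₂) gM.val w) ∧
      (∀ z, 0 ≤ g₁.meanCurvature b₁.incl Literature.Geometry.Lorentzian.PseudoRiemannianMetric.contMDiff_pullbackBilin_holds hf₁ ν₁ z +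
        gM.meanCurvature bM.incl Literature.Geometry.Lorentzian.PseudoRiemannianMetric.contMDiff_pullbackBilin_holds hfM νM (φ₁ z)) ∧
      (∀ w, 0 ≤ g₂.meanCurvature b₂.incl Literature.Geometry.Lorentzian.PseudoRiemannianMetric.contMDiff_pullbackBilin_holds hf₂ ν₂ w +
        gM.meanCurvature bM.incl Literature.Geometry.Lorentzian.PseudoRiemannianMetric.contMDiff_pullbackBilin_holds hfM νM (φ₂ w)) ∧
      (∀ z, 0 ≤ g₁.meanCurvature b₁.incl Literature.Geometry.Lorentzian.PseudoRiemannianMetric.contMDiff_pullbackBilin_holds hf₁ ν₁ z +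
        g₂.meanCurvature b₂.incl Literature.Geometry.Lorentzian.PseudoRiemannianMetric.contMDiff_pullbackBilin_holds hf₂ ν₂ (φ₂.symm (φ₁ z))) ∧
      (∀ z, 0 ≤ g₁.meanCurvature b₁.incl Literature.Geometry.Lorentzian.PseudoRiemannianMetric.contMDiff_pullbackBilin_holds hf₁ ν₁ z)) :
    Summit.SmoothPoincare4.SmoothPoincare4.Theses.PIC.PicPscV2 := by
  intro S
  -- `Θ₄ = 0`: `Σ` is simply connected and h-cobordant to `S⁴`
  have hΘ : Literature.Topology.FourManifolds.isHCobordant_sphere_of_homotopySphere_four :=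
    Literature.Topology.FourManifolds.isHCobordant_sphere_of_homotopySphere_four_of_frontier₄ h31
      Literature.Topology.FourManifolds.boundsParallelizable_of_collapseNullHomotopic_holds hPi
      Literature.Topology.FourManifolds.HomotopySphere.boundsContractible_of_nullCobordism_isStablyParallelizable_four_holds
  obtain ⟨e⟩ := S.nonempty_homotopyEquiv
  haveI : SimplyConnectedSpace (Metric.sphere (0 : EuclideanSpace ℝ (Fin 5)) 1) :=
    Literature.Topology.FourManifolds.simplyConnectedSpace_sphere_four_holds
  haveI : SimplyConnectedSpace S.carrier := e.simplyConnectedSpace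
  have hcob : Literature.Topology.FourManifolds.IsHCobordant 4
      (Metric.sphere (0 : EuclideanSpace ℝ (Fin 5)) 1) S.carrier := (hΘ S).symm
  -- the Matveyev triple of `(S⁴, Σ)`
  obtain ⟨W₁, W₂, M, _, _, _, _, _, _, _, _, _, _, _, _, _, _, _, b₁, b₂, bM, φ₁, φ₂, hc₁, hk₁, hc₂, hk₂,
    hcM, hX₁, hX₂, hD, hA'⟩ :=
    Literature.Topology.FourManifolds.matveyev1996_partOne_and_fact_of_dualSpheres h4
      (Metric.sphere (0 : EuclideanSpace ℝ (Fin 5)) 1) S.carrier hcob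
  -- the cross-filling metrics (only `g₂`, `g_M`, the `W₂`/`M` boundary identity and (ii) are used)
  obtain ⟨g₁, hL₁, hf₁, ν₁, g₂, hL₂, hf₂, ν₂, gM, hLM, hfM, νM, -, hg₂, hgM, -, hb₂, -, hii, -, -⟩ :=
    hA W₁ b₁ W₂ b₂ M bM φ₁ φ₂ hX₁ hD hA'
  exact psc_of_crossFillingPair hBH b₂ bM φ₂ hX₂ g₂ hL₂ hf₂ ν₂ gM hLM hfM νM hg₂ hgM hb₂ hii

/-- The same conclusion under its other name in the tree, the target of the retired route
PscCorkFillIn: `…Theses.PscCorkFillIn.PscAllHomotopySpheres` (definitionally `PicPscV2`). [folklore] -/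
theorem pscAllHomotopySpheres_of_crossFilling (hBH : Literature.Geometry.Riemannian.BaerHankePscGluing)
    (h31 : ∀ S : Literature.Topology.FourManifolds.HomotopySphere 4,
      Literature.Topology.FourManifolds.IsStablyParallelizable (𝓡 4) S.carrier)
    (hPi : Literature.Topology.FourManifolds.piStable_four_trivial)
    (h4 : Literature.Topology.FourManifolds.Matveyev1996_partOne_and_fact_of_dualSpheres.{0})
    (hA :

      ∀ (W₁ : Type) [TopologicalSpace W₁] [T2Space W₁] [SecondCountableTopology W₁]
      [ChartedSpace (EuclideanHalfSpace 4) W₁] [IsManifold (𝓡∂ 4) ∞ W₁] [CompactSpace W₁] [ContractibleSpace W₁]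
      (b₁ : Literature.Topology.FourManifolds.BoundaryData (𝓡∂ 4) W₁ (𝓡 3))
      (W₂ : Type) [TopologicalSpace W₂] [T2Space W₂] [SecondCountableTopology W₂]
      [ChartedSpace (EuclideanHalfSpace 4) W₂] [IsManifold (𝓡∂ 4) ∞ W₂] [CompactSpace W₂] [ContractibleSpace W₂]
      (b₂ : Literature.Topology.FourManifolds.BoundaryData (𝓡∂ 4) W₂ (𝓡 3))
      (M : Type) [TopologicalSpace M] [T2Space M] [SecondCountableTopology M]
      [ChartedSpace (EuclideanHalfSpace 4) M] [IsManifold (𝓡∂ 4) ∞ M] [CompactSpace M]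
      (bM : Literature.Topology.FourManifolds.BoundaryData (𝓡∂ 4) M (𝓡 3))
      (φ₁ : b₁.carrier ≃ₘ⟮𝓡 3, 𝓡 3⟯ bM.carrier) (φ₂ : b₂.carrier ≃ₘ⟮𝓡 3, 𝓡 3⟯ bM.carrier),
      Literature.Topology.FourManifolds.IsBoundaryGluing b₁ bM φ₁ (𝓡 4) (Metric.sphere (0 : EuclideanSpace ℝ (Fin 5)) 1) →
      Literature.Topology.FourManifolds.IsDouble b₁ (𝓡 4) (Metric.sphere (0 : EuclideanSpace ℝ (Fin 5)) 1) →
      Literature.Topology.FourManifolds.IsBoundaryGluing b₁ b₂ (φ₁.trans φ₂.symm) (𝓡 4) (Metric.sphere (0 : EuclideanSpace ℝ (Fin 5)) 1) →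
      ∃ (g₁ : Literature.Geometry.Lorentzian.PseudoRiemannianMetric (𝓡∂ 4) ∞ (EuclideanSpace ℝ (Fin 4)) (TangentSpace (𝓡∂ 4) : W₁ → Type _))
      (_ : g₁.HasLeviCivita) (hf₁ : g₁.IsSpacelikeImmersion (𝓡 3) b₁.incl)
      (ν₁ : Literature.Geometry.Lorentzian.NormalField (𝓡∂ 4) b₁.incl)
      (g₂ : Literature.Geometry.Lorentzian.PseudoRiemannianMetric (𝓡∂ 4) ∞ (EuclideanSpace ℝ (Fin 4)) (TangentSpace (𝓡∂ 4) : W₂ → Type _))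
      (_ : g₂.HasLeviCivita) (hf₂ : g₂.IsSpacelikeImmersion (𝓡 3) b₂.incl)
      (ν₂ : Literature.Geometry.Lorentzian.NormalField (𝓡∂ 4) b₂.incl)
      (gM : Literature.Geometry.Lorentzian.PseudoRiemannianMetric (𝓡∂ 4) ∞ (EuclideanSpace ℝ (Fin 4)) (TangentSpace (𝓡∂ 4) : M → Type _))
      (_ : gM.HasLeviCivita) (hfM : gM.IsSpacelikeImmersion (𝓡 3) bM.incl)
      (νM : Literature.Geometry.Lorentzian.NormalField (𝓡∂ 4) bM.incl),
      (g₁.IsRiemannian ∧ (∀ x, 0 < g₁.scalarCurvature x) ∧ g₁.IsUnitNormal (𝓡 3) b₁.incl ν₁ 1 ∧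
        ContMDiff (𝓡 3) (𝓡∂ 4).tangent ∞ (fun z ↦ (Bundle.TotalSpace.mk' (EuclideanSpace ℝ (Fin 4)) (b₁.incl z) (ν₁ z) : TangentBundle (𝓡∂ 4) W₁)) ∧
        (∀ z, (show EuclideanSpace ℝ (Fin 4) from ν₁ z) 0 < 0)) ∧
      (g₂.IsRiemannian ∧ (∀ x, 0 < g₂.scalarCurvature x) ∧ g₂.IsUnitNormal (𝓡 3) b₂.incl ν₂ 1 ∧
        ContMDiff (𝓡 3) (𝓡∂ 4).tangent ∞ (fun w ↦ (Bundle.TotalSpace.mk' (EuclideanSpace ℝ (Fin 4)) (b₂.incl w) (ν₂ w) : TangentBundle (𝓡∂ 4) W₂)) ∧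
        (∀ w, (show EuclideanSpace ℝ (Fin 4) from ν₂ w) 0 < 0)) ∧
      (gM.IsRiemannian ∧ (∀ x, 0 < gM.scalarCurvature x) ∧ gM.IsUnitNormal (𝓡 3) bM.incl νM 1 ∧
        ContMDiff (𝓡 3) (𝓡∂ 4).tangent ∞ (fun m ↦ (Bundle.TotalSpace.mk' (EuclideanSpace ℝ (Fin 4)) (bM.incl m) (νM m) : TangentBundle (𝓡∂ 4) M)) ∧
        (∀ m, (show EuclideanSpace ℝ (Fin 4) from νM m) 0 < 0)) ∧
      (∀ z, Literature.Geometry.Lorentzian.pullbackBilin (I := 𝓡∂ 4) (I' := 𝓡 3) b₁.incl g₁.val z =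
        Literature.Geometry.Lorentzian.pullbackBilin (I := 𝓡∂ 4) (I' := 𝓡 3) (bM.incl ∘ φ₁) gM.val z) ∧
      (∀ w, Literature.Geometry.Lorentzian.pullbackBilin (I := 𝓡∂ 4) (I' := 𝓡 3) b₂.incl g₂.val w =
        Literature.Geometry.Lorentzian.pullbackBilin (I := 𝓡∂ 4) (I' := 𝓡 3) (bM.incl ∘ φ₂) gM.val w) ∧
      (∀ z, 0 ≤ g₁.meanCurvature b₁.incl Literature.Geometry.Lorentzian.PseudoRiemannianMetric.contMDiff_pullbackBilin_holds hf₁ ν₁ z +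
        gM.meanCurvature bM.incl Literature.Geometry.Lorentzian.PseudoRiemannianMetric.contMDiff_pullbackBilin_holds hfM νM (φ₁ z)) ∧
      (∀ w, 0 ≤ g₂.meanCurvature b₂.incl Literature.Geometry.Lorentzian.PseudoRiemannianMetric.contMDiff_pullbackBilin_holds hf₂ ν₂ w +
        gM.meanCurvature bM.incl Literature.Geometry.Lorentzian.PseudoRiemannianMetric.contMDiff_pullbackBilin_holds hfM νM (φ₂ w)) ∧
      (∀ z, 0 ≤ g₁.meanCurvature b₁.incl Literature.Geometry.Lorentzian.PseudoRiemannianMetric.contMDiff_pullbackBilin_holds hf₁ ν₁ z +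
        g₂.meanCurvature b₂.incl Literature.Geometry.Lorentzian.PseudoRiemannianMetric.contMDiff_pullbackBilin_holds hf₂ ν₂ (φ₂.symm (φ₁ z))) ∧
      (∀ z, 0 ≤ g₁.meanCurvature b₁.incl Literature.Geometry.Lorentzian.PseudoRiemannianMetric.contMDiff_pullbackBilin_holds hf₁ ν₁ z)) :
    Summit.SmoothPoincare4.SmoothPoincare4.Theses.PscCorkFillIn.PscAllHomotopySpheres :=
  picPscV2_of_crossFilling hBH h31 hPi h4 hA

end Summit.SmoothPoincare4.SmoothPoincare4.Theorems

end
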